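import Summits.QuantumFields.YangMills.Theorems.BalabanUVNodesN15KingModelSlicesTwoSpacingSup
import Summits.QuantumFields.YangMills.Theorems.BalabanUVNodesN15KingModelSlicesTwoSpacingInterpolation
import HarnessLib

/-!
# BalabanUVNodes ∕ N15 — THE KING-MODEL RUNG, CURVED EDITION (PART Χ-c): KING 1986 PROPOSITION 3.9, THE HÖLDER LINES (3.75) **AT `A = 0`** FOR THE DATUM
# `kingSlicesTwoSpacing` (part Χ-a) — `|(∂_α(x′, y′)G^{η′}_{(j)})(z′) − (∂_α(x, y)G^η_{(j)})(z)| ≤ C·L^{−γk}·(L^jη)^{2−D−α−γ}·e^{−δ₀ dist({x, y}, z)}` and the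
# gradient twin, for EVERY Hölder exponent `0 < α < 1` with a rate `γ = γ(α) = (1−α)∕(4(1+α)) > 0` — King's «0 < α < 1, and γ sufficiently small» — ONE
# `(C, δ₀)` per `α`, UNIFORM in `k, n ≥ 1`, the cube `2L^{e_M}` and the mass `0 < m² ≤ m₀²`
# (Track A, DAG node N15 = NE2; FAN-OUT v1.1 §N15 s3 «KING-MODEL RUNG … NE2's analogue DECIDED in the model»)

HONEST FRAMING.  Count-neutral (cell `pub-ymgap`, seat `pub-ymgap-dag-n15-e` g18; `--supports stmt-QuantumFields-27366 --as helper` = K3⁸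
`SpineGivenEndpointR13SepCoPHV`).  TEMPLATE LITERATURE, `A = 0`: C. King's scalar U(1)-Higgs MODEL on finite tori ([King1986] Prop. 3.9 (3.75) p. 665 —
PRINTED and proved there (§4, (4.43) p. 675 with Hölder norms); here DECIDED for the tree's objects at `A = 0`, `Ω = T_η`), NOT Bałaban's covariant objects;
NE2⁺ is NOT PRINTED for those and not proved; NOT a node discharge; nothing continuum ∕ ℝ⁴ ∕ OS ∕ mass-gap ∕ Clay.  0 `sorry`, 0 `def`; standard axioms.

THE METHOD (not King's three-factor Hölder replacement; an interpolation that yields the printed SHAPE with King's quantifier order): part Χ-c₁'s abstract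
`twoSpacing_holderLine` — the two-spacing SUP line (3.73) at the rate `¼` (part Χ-b `kingSlicesTwoSpacing_ineq373`) interpolated against the one-spacing
HÖLDER letters (3.65) at the exponent `α′ = (1+α)∕2` for BOTH runs (part Ρ-f `kingSliceKernels_ineq365a∕b` on the `k`-level datum and on the `(k+n)`-level
datum at slice `j + n`), plus the pairing defect `|x − y|_η vs |x′ − y′|_{η′}` (Χ-a `dist_kingSlicePt_le`∕`dist_le_kingSlicePt`∕`eta_le_dist_of_pos`, one coarse
spacing `η = L^{−k}`), gives the rate `L^{−γj} = L^{−γk}(L^jη)^{−γ}` with `γ = min(¼·(1 − α∕α′), α′ − α)`-type exponents; here `γ(α) := (1 − α∕α′)∕4 =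
(1−α)∕(4(1+α)) ≤ α′ − α`.  This is exactly why `γ` must be chosen AFTER `α` (`SlicePropagator.Prop39KingOrder`, not the family-uniform `Prop39Printed`).
MAIN RESULT ★★ `kingSlicesTwoSpacing_ineq375` (both Hölder lines, all `0 ≤ j ≤ k − 1`, in the letters of `Prop39PrintedAt`: `holderDeriv T.hi.dist α (T.hi.G j)`,
`T.lo`, `T.pt`, `T.lo.slice`, `min (T.lo.dist …) (T.lo.dist …)`), with `0 < γ < ½` recorded so that part Χ-d can read (3.73) at the SAME `γ`.
HONEST SCOPE: `A = 0`, periodic b.c., odd `L ≥ 3`, `k, n ≥ 1`, cube `2L^{e_M}`, `0 < m² ≤ m₀²`, `0 < α < 1`; the (2.20)∕(2.17) dictionary APPLIED as the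
definition of the level-`k` kernels (parts Ρ-e∕Χ-a); the rate `γ(α)` is ours (King does not print his `γ`).  WHAT THE CURVED CASE ADDS (one line): (3.75)
for `G_(j)(Ω, A)`, regular `A ≠ 0`, `Ω ⊊ T_η` — [King1986] §4, not in the model.
Locators: [King1986] (3.62) p.663, Prop. 3.7 (3.65) p.663, p.664 (pairing), Prop. 3.9 (3.73)∕(3.75) p.665, (4.43) p.675.
-/

noncomputable section

namespace Summit.QuantumFields.YangMills.BalabanUVNodes.N15KingModelRung.Curved

open Real Finset Matrix
open Literature.MathematicalPhysics.QuantumFieldTheory.Balaban1983to89.B5Prop11Plancherel (Tor fine unitVec)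
open Literature.MathematicalPhysics.QuantumFieldTheory.King1986.Torus (tdistT tdistT_nonneg)
open Literature.MathematicalPhysics.QuantumFieldTheory.King1986.SlicePropagator (SliceKernels TwoSpacing holderDeriv)

variable {d : ℕ} (L : ℕ) [NeZero L]

/-! ## §1 The data's language and the rate letters -/

section Letters

variable {L} {k n eM : ℕ} (M : Fin (d + 1) → ℕ) [∀ μ, NeZero (M μ)] (hM : ∀ μ, M μ = 2 * L ^ eM) (hk : 1 ≤ k) (a msq : ℝ)

/-- Reading: the Prop.-3.7 datum's block factor. [folklore] -/
theorem kingSliceKernels_L : (kingSliceKernels L k eM M hM hk a msq).L = L := rfl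

/-- Reading: the Prop.-3.7 datum's level. [folklore] -/
theorem kingSliceKernels_k : (kingSliceKernels L k eM M hM hk a msq).k = k := rfl

/-- Reading: the fine kernels ARE the `(k+n)`-level Prop.-3.7 datum's slices `j + n` (as functions). [cite: King1986, Prop. 3.7 p.663 («Furthermore»)] -/
theorem kingSlicesTwoSpacing_hiG' (j : ℕ) :
    (kingSlicesTwoSpacing L k n eM M hM hk a msq).hi.G j = (kingSliceKernels L (k + n) eM M hM (one_le_add_of_one_le hk n) a msq).G (j + n) := rfl

/-- Reading: the fine gradient kernels likewise. [cite: King1986, Prop. 3.7 p.663 («Furthermore»)] -/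
theorem kingSlicesTwoSpacing_hidG' (j : ℕ) (μ : Fin (d + 1)) :
    (kingSlicesTwoSpacing L k n eM M hM hk a msq).hi.dG j μ
      = (kingSliceKernels L (k + n) eM M hM (one_le_add_of_one_le hk n) a msq).dG (j + n) μ := rfl

/-- Reading: the fine distance is the `(k+n)`-level datum's. [folklore] -/
theorem kingSlicesTwoSpacing_hidist' :
    (kingSlicesTwoSpacing L k n eM M hM hk a msq).hi.dist = (kingSliceKernels L (k + n) eM M hM (one_le_add_of_one_le hk n) a msq).dist := rfl

variable (L)

omit [NeZero L] in
/-- `((L^{−¼})^j)^θ = (L^{−θ∕4})^j`. [folklore] -/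
theorem ratePow_rpow_eq (θ : ℝ) (j : ℕ) : (((L : ℝ) ^ (-(1 / 4 : ℝ))) ^ j) ^ θ = ((L : ℝ) ^ (-(θ / 4))) ^ j := by
  have hL0 : (0 : ℝ) ≤ L := Nat.cast_nonneg _
  have hx : 0 ≤ (L : ℝ) ^ (-(1 / 4 : ℝ)) := Real.rpow_nonneg hL0 _
  rw [← Real.rpow_natCast _ j, ← Real.rpow_mul hx, mul_comm, Real.rpow_mul hx, Real.rpow_natCast, ← Real.rpow_mul hL0]
  congr 2; ring

/-- `(η∕(L^jη))^t = (L^{−t})^j` with `η = 1∕L^k`, `L^jη = L^j∕L^k`. [folklore] -/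
theorem etaOverSlice_rpow_eq (t : ℝ) (j k : ℕ) :
    (1 / (L : ℝ) ^ k / ((L : ℝ) ^ j / (L : ℝ) ^ k)) ^ t = ((L : ℝ) ^ (-t)) ^ j := by
  have hL0 : (0 : ℝ) < L := by exact_mod_cast Nat.pos_of_ne_zero (NeZero.ne L)
  have hj : (0 : ℝ) < (L : ℝ) ^ j := pow_pos hL0 _
  have hk : (0 : ℝ) < (L : ℝ) ^ k := pow_pos hL0 _
  have h1 : 1 / (L : ℝ) ^ k / ((L : ℝ) ^ j / (L : ℝ) ^ k) = ((L : ℝ) ^ j)⁻¹ := by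
    field_simp
  rw [h1, Real.inv_rpow hj.le, ← Real.rpow_neg hj.le, ← Real.rpow_mul_natCast hL0.le, ← Real.rpow_natCast_mul hL0.le, mul_comm]

/-- The rate letter is monotone in the exponent: `(L^{−t})^j ≤ (L^{−γ})^j` for `γ ≤ t` (`L ≥ 1`). [folklore] -/
theorem ratePow_mono {γ t : ℝ} (h : γ ≤ t) (j : ℕ) : ((L : ℝ) ^ (-t)) ^ j ≤ ((L : ℝ) ^ (-γ)) ^ j := by
  have hL0 : (0 : ℝ) ≤ L := Nat.cast_nonneg _
  have hL1 : (1 : ℝ) ≤ L := by exact_mod_cast Nat.one_le_iff_ne_zero.mpr (NeZero.ne L)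
  exact pow_le_pow_left₀ (Real.rpow_nonneg hL0 _) (Real.rpow_le_rpow_of_exponent_le hL1 (by linarith)) j

end Letters

/-! ## §2 (3.75) for the datum, both lines, King's quantifier order -/

section Holder

/-- ★★ **KING's (3.75) AT `A = 0`, BOTH LINES, ALL SLICES `0 ≤ j ≤ k − 1`, IN THE LETTERS OF `SlicePropagator.Prop39PrintedAt`**: for odd `L ≥ 3`, `a > 0`,
`m₀² ≥ 0` and every Hölder exponent `0 < α < 1` there are `C, δ₀ > 0` and a rate `0 < γ < ½` (namely `γ = (1−α)∕(4(1+α))`) such that for EVERY `k, n ≥ 1`,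
cube `2L^{e_M}`, mass `0 < m² ≤ m₀²`, the datum `T = kingSlicesTwoSpacing L k n e_M M a m²` satisfies, for all `j + 1 ≤ k` and `x′, y′, z′ ∈ T_{η′}` with
`|x′ − y′| > 0`, `|x − y| > 0`: `|∂_α(x′, y′)G^{η′}_{(j)}(z′) − ∂_α(x, y)G^η_{(j)}(z)| ≤ C·L^{−γk}·(T.lo.slice j)^{2−D−α−γ}·exp(−δ₀·min(T.lo.dist x z, T.lo.dist y z))`
and the gradient line with `(T.lo.slice j)^{1−D−α−γ}` — the third conjunct of `Prop39PrintedAt α T C δ₀ γ` at slice `j`.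
[cite: King1986, Prop. 3.9 (3.75) p.665 («0 < α < 1, and γ sufficiently small»), (3.62) p.663, (4.43) p.675] -/
theorem kingSlicesTwoSpacing_ineq375 (hLodd : Odd L) (hL : 2 ≤ L) {a : ℝ} (ha : 0 < a) {m0sq : ℝ} (hm0 : 0 ≤ m0sq) {α : ℝ}
    (hα0 : 0 < α) (hα1 : α < 1) :
    ∃ C δ₀ γ : ℝ, 0 < C ∧ 0 < δ₀ ∧ 0 < γ ∧ γ < 1 / 2 ∧
    ∀ (k n eM : ℕ) (hk : 1 ≤ k) (_hn : 1 ≤ n) (M : Fin (d + 1) → ℕ) [∀ μ, NeZero (M μ)] (hM : ∀ μ, M μ = 2 * L ^ eM)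
      (msq : ℝ), 0 < msq → msq ≤ m0sq → ∀ j : ℕ, j + 1 ≤ (kingSlicesTwoSpacing L k n eM M hM hk a msq).lo.k →
      ∀ x' y' z' : Tor (fine (L ^ (k + n)) M), 0 < (kingSlicesTwoSpacing L k n eM M hM hk a msq).hi.dist x' y' →
      0 < (kingSlicesTwoSpacing L k n eM M hM hk a msq).lo.dist ((kingSlicesTwoSpacing L k n eM M hM hk a msq).pt x')
            ((kingSlicesTwoSpacing L k n eM M hM hk a msq).pt y') →
      |holderDeriv (kingSlicesTwoSpacing L k n eM M hM hk a msq).hi.dist α ((kingSlicesTwoSpacing L k n eM M hM hk a msq).hi.G j) x' y' z'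
          - holderDeriv (kingSlicesTwoSpacing L k n eM M hM hk a msq).lo.dist α ((kingSlicesTwoSpacing L k n eM M hM hk a msq).lo.G j)
              ((kingSlicesTwoSpacing L k n eM M hM hk a msq).pt x') ((kingSlicesTwoSpacing L k n eM M hM hk a msq).pt y')
              ((kingSlicesTwoSpacing L k n eM M hM hk a msq).pt z')|
        ≤ C * ((kingSlicesTwoSpacing L k n eM M hM hk a msq).lo.L : ℝ) ^ (-(γ * (kingSlicesTwoSpacing L k n eM M hM hk a msq).lo.k))
            * ((kingSlicesTwoSpacing L k n eM M hM hk a msq).lo.slice j) ^ ((2 : ℝ) - (d + 1 : ℕ) - α - γ)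
            * Real.exp (-(δ₀ * min
                ((kingSlicesTwoSpacing L k n eM M hM hk a msq).lo.dist ((kingSlicesTwoSpacing L k n eM M hM hk a msq).pt x')
                  ((kingSlicesTwoSpacing L k n eM M hM hk a msq).pt z'))
                ((kingSlicesTwoSpacing L k n eM M hM hk a msq).lo.dist ((kingSlicesTwoSpacing L k n eM M hM hk a msq).pt y')
                  ((kingSlicesTwoSpacing L k n eM M hM hk a msq).pt z')))) ∧
      ∀ μ : Fin (d + 1),
        |holderDeriv (kingSlicesTwoSpacing L k n eM M hM hk a msq).hi.dist α ((kingSlicesTwoSpacing L k n eM M hM hk a msq).hi.dG j μ) x' y' z'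
            - holderDeriv (kingSlicesTwoSpacing L k n eM M hM hk a msq).lo.dist α ((kingSlicesTwoSpacing L k n eM M hM hk a msq).lo.dG j μ)
                ((kingSlicesTwoSpacing L k n eM M hM hk a msq).pt x') ((kingSlicesTwoSpacing L k n eM M hM hk a msq).pt y')
                ((kingSlicesTwoSpacing L k n eM M hM hk a msq).pt z')|
          ≤ C * ((kingSlicesTwoSpacing L k n eM M hM hk a msq).lo.L : ℝ) ^ (-(γ * (kingSlicesTwoSpacing L k n eM M hM hk a msq).lo.k))
              * ((kingSlicesTwoSpacing L k n eM M hM hk a msq).lo.slice j) ^ ((1 : ℝ) - (d + 1 : ℕ) - α - γ)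
              * Real.exp (-(δ₀ * min
                  ((kingSlicesTwoSpacing L k n eM M hM hk a msq).lo.dist ((kingSlicesTwoSpacing L k n eM M hM hk a msq).pt x')
                    ((kingSlicesTwoSpacing L k n eM M hM hk a msq).pt z'))
                  ((kingSlicesTwoSpacing L k n eM M hM hk a msq).lo.dist ((kingSlicesTwoSpacing L k n eM M hM hk a msq).pt y')
                    ((kingSlicesTwoSpacing L k n eM M hM hk a msq).pt z')))) := by
  -- the exponents: `α′ = (1+α)/2`, `θ = 1 − α/α′`, `γ = θ/4`
  set α' : ℝ := (1 + α) / 2 with hα'def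
  have hα'0 : 0 < α' := by rw [hα'def]; linarith
  have hαα' : α < α' := by rw [hα'def]; linarith
  have hα'1 : α' < 1 := by rw [hα'def]; linarith
  set θ : ℝ := 1 - α / α' with hθdef
  have hθ0 : 0 < θ := by
    have : α / α' < 1 := (div_lt_one hα'0).mpr hαα'
    rw [hθdef]; linarith
  have hθ1 : θ < 1 := by
    have : 0 < α / α' := div_pos hα0 hα'0
    rw [hθdef]; linarith
  have hθε : θ ≤ 1 - α := by
    -- `θ = (α′ − α)/α′ ≤ (α′ − α)/(1/2) = 1 − α`
    have hθ' : θ = (α' - α) / α' := by rw [hθdef]; field_simp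
    rw [hθ', div_le_iff₀ hα'0, hα'def]
    nlinarith
  set γ : ℝ := θ / 4 with hγdef
  have hγ0 : 0 < γ := by rw [hγdef]; linarith
  have hγ1 : γ < 1 / 2 := by rw [hγdef]; linarith
  have hγε : γ ≤ α' - α := by rw [hγdef, hα'def]; linarith
  -- the letters
  obtain ⟨C₁, δ₁, hC₁, hδ₁, H₁⟩ := kingSlicesTwoSpacing_ineq373 (d := d) L hLodd hL ha hm0 (γ := 1 / 4) (by norm_num) (by norm_num)
  obtain ⟨Ca, δa, hCa, hδa, Ha⟩ := kingSliceKernels_ineq365a (d := d) L hLodd hL ha hm0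
  obtain ⟨Cb, δb, hCb, hδb, Hb⟩ := kingSliceKernels_ineq365b (d := d) L hLodd hL ha hm0 hα'0 hα'1
  set C₂ : ℝ := Ca + Cb with hC₂def
  set δ₂ : ℝ := min δa δb with hδ₂def
  have hC₂ : 0 < C₂ := by positivity
  have hδ₂ : 0 < δ₂ := lt_min hδa hδb
  have hL0 : (0 : ℝ) < L := by exact_mod_cast Nat.pos_of_ne_zero (NeZero.ne L)
  have hL1 : (1 : ℝ) ≤ L := by exact_mod_cast Nat.one_le_iff_ne_zero.mpr (NeZero.ne L)
  -- the constants of record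
  set K₁ : ℝ := (2 * C₁) ^ (1 - α / α') * (3 * (C₂ * Real.exp δ₂)) ^ (α / α') with hK₁def
  set K₂ : ℝ := 3 * (C₂ * Real.exp δ₂) with hK₂def
  have hK₁ : 0 ≤ K₁ := mul_nonneg (Real.rpow_nonneg (by positivity) _) (Real.rpow_nonneg (by positivity) _)
  have hK₂ : 0 ≤ K₂ := by positivity
  refine ⟨K₁ + K₂ + 1, min δ₁ δ₂, γ, by positivity, lt_min hδ₁ hδ₂, hγ0, hγ1, ?_⟩
  intro k n eM hk hn M _ hM msq hmsq hcap j hj x' y' z' hxy hxy'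
  rw [kingSlicesTwoSpacing_lok] at hj
  have hjk : j < k := by omega
  have hk' : 1 ≤ k + n := one_le_add_of_one_le hk n
  simp only [kingSlicesTwoSpacing_lo, kingSliceKernels_L, kingSliceKernels_k, kingSliceKernels_slice, kingSlicesTwoSpacing_pt,
    kingSlicesTwoSpacing_hiG', kingSlicesTwoSpacing_hidG', kingSlicesTwoSpacing_hidist'] at hxy hxy' ⊢
  -- abbreviations
  have hs : 0 < (L : ℝ) ^ j / (L : ℝ) ^ k := div_pos (pow_pos hL0 _) (pow_pos hL0 _)
  have hs1 : ((L : ℝ) ^ j / (L : ℝ) ^ k) ≤ 1 := sliceRatio_le_one L hjk.le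
  have hLk : (0 : ℝ) < (L : ℝ) ^ k := pow_pos hL0 _
  have hη : (0 : ℝ) < 1 / (L : ℝ) ^ k := by positivity
  have hη1 : 1 / (L : ℝ) ^ k ≤ 1 := by rw [div_le_one hLk]; exact one_le_pow₀ hL1
  have hρ : (0 : ℝ) < ((L : ℝ) ^ (-(1 / 4 : ℝ))) ^ j := pow_pos (Real.rpow_pos_of_pos hL0 _) _
  have hslice_hi : (kingSliceKernels L (k + n) eM M hM hk' a msq).slice (j + n) = (L : ℝ) ^ j / (L : ℝ) ^ k := by
    rw [kingSliceKernels_slice, pow_div_pow_shift]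
  have hslice_lo : (kingSliceKernels L k eM M hM hk a msq).slice j = (L : ℝ) ^ j / (L : ℝ) ^ k := by rw [kingSliceKernels_slice]
  -- geometry of the pairing in the data's language (`(kingSliceKernels L k eM M hM hk a msq).dist = tdistT/L^k`, `(kingSliceKernels L (k + n) eM M hM hk' a msq).dist = tdistT′/L^{k+n}` by `rfl`)
  have hdhi : ∀ u v : Tor (fine (L ^ (k + n)) M), 0 ≤ (kingSliceKernels L (k + n) eM M hM hk' a msq).dist u v := fun u v => div_nonneg (tdistT_nonneg _ _ _) (pow_pos hL0 _).le
  have hdlo : ∀ u v : Tor (fine (L ^ k) M), 0 ≤ (kingSliceKernels L k eM M hM hk a msq).dist u v := fun u v => div_nonneg (tdistT_nonneg _ _ _) hLk.le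
  have hgeo1 : ∀ u v : Tor (fine (L ^ (k + n)) M), (kingSliceKernels L k eM M hM hk a msq).dist (kingSlicePt L k n M u) (kingSlicePt L k n M v) ≤ (kingSliceKernels L (k + n) eM M hM hk' a msq).dist u v + 1 / (L : ℝ) ^ k :=
    fun u v => dist_kingSlicePt_le L k n M u v
  have hgeo2 : ∀ u v : Tor (fine (L ^ (k + n)) M), (kingSliceKernels L (k + n) eM M hM hk' a msq).dist u v ≤ (kingSliceKernels L k eM M hM hk a msq).dist (kingSlicePt L k n M u) (kingSlicePt L k n M v) + 1 / (L : ℝ) ^ k :=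
    fun u v => dist_le_kingSlicePt L k n M u v
  have hgeo3 : ∀ u v : Tor (fine (L ^ k) M), 0 < (kingSliceKernels L k eM M hM hk a msq).dist u v → 1 / (L : ℝ) ^ k ≤ (kingSliceKernels L k eM M hM hk a msq).dist u v :=
    fun u v huv => eta_le_dist_of_pos hLk u v huv
  -- the rate letter at `¼`: `L^{−k/4}·((L : ℝ) ^ j / (L : ℝ) ^ k)^{e−¼} = ((L : ℝ) ^ j / (L : ℝ) ^ k)^e·(L^{−¼})^j`
  have hrate : ∀ e : ℝ, (L : ℝ) ^ (-(1 / 4 * (k : ℝ))) * ((L : ℝ) ^ j / (L : ℝ) ^ k) ^ (e - 1 / 4) = ((L : ℝ) ^ j / (L : ℝ) ^ k) ^ e * ((L : ℝ) ^ (-(1 / 4 : ℝ))) ^ j :=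
    fun e => schemaRate_eq L (1 / 4) e j k
  -- Hölder-letter monotonicity to the common `(C₂, δ₂)`
  have hmonoH : ∀ {Ci δi : ℝ} (e W : ℝ), 0 ≤ W → Ci ≤ C₂ → δ₂ ≤ δi →
      Ci * ((L : ℝ) ^ j / (L : ℝ) ^ k) ^ e * Real.exp (-(δi * ((L : ℝ) ^ j / (L : ℝ) ^ k)⁻¹ * W)) ≤ C₂ * ((L : ℝ) ^ j / (L : ℝ) ^ k) ^ e * Real.exp (-(δ₂ * ((L : ℝ) ^ j / (L : ℝ) ^ k)⁻¹ * W)) := by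
    intro Ci δi e W hW hCi hδi
    refine mul_le_mul (mul_le_mul_of_nonneg_right hCi (Real.rpow_nonneg hs.le _)) (Real.exp_le_exp.mpr ?_) (Real.exp_nonneg _)
      (mul_nonneg hC₂.le (Real.rpow_nonneg hs.le _))
    have : δ₂ * ((L : ℝ) ^ j / (L : ℝ) ^ k)⁻¹ * W ≤ δi * ((L : ℝ) ^ j / (L : ℝ) ^ k)⁻¹ * W := mul_le_mul_of_nonneg_right (mul_le_mul_of_nonneg_right hδi (inv_nonneg.mpr hs.le)) hW
    linarith
  have hca : Ca ≤ C₂ := by rw [hC₂def]; linarith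
  have hcb : Cb ≤ C₂ := by rw [hC₂def]; linarith
  have hda : δ₂ ≤ δa := min_le_left _ _
  have hdb : δ₂ ≤ δb := min_le_right _ _
  -- the final conversion: `[K₁ρ^θ + K₂(η/((L : ℝ) ^ j / (L : ℝ) ^ k))^{α′−α}]·((L : ℝ) ^ j / (L : ℝ) ^ k)^{e−α}·W ≤ (K₁+K₂+1)·L^{−γk}·((L : ℝ) ^ j / (L : ℝ) ^ k)^{e−α−γ}·W`
  have hfinal : ∀ (e W : ℝ), 0 ≤ W →
      (K₁ * (((L : ℝ) ^ (-(1 / 4 : ℝ))) ^ j) ^ (1 - α / α') + K₂ * (1 / (L : ℝ) ^ k / ((L : ℝ) ^ j / (L : ℝ) ^ k)) ^ (α' - α)) * ((L : ℝ) ^ j / (L : ℝ) ^ k) ^ (e - α) * W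
        ≤ (K₁ + K₂ + 1) * (L : ℝ) ^ (-(γ * k)) * ((L : ℝ) ^ j / (L : ℝ) ^ k) ^ (e - α - γ) * W := by
    intro e W hW
    rw [mul_assoc (K₁ + K₂ + 1), schemaRate_eq L γ (e - α) j k, ratePow_rpow_eq, etaOverSlice_rpow_eq]
    have hγθ : ((L : ℝ) ^ (-((1 - α / α') / 4))) ^ j = ((L : ℝ) ^ (-γ)) ^ j := by rw [hγdef, hθdef]
    rw [hγθ]
    have h2 : ((L : ℝ) ^ (-(α' - α))) ^ j ≤ ((L : ℝ) ^ (-γ)) ^ j := ratePow_mono L hγε j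
    have hρ' : 0 ≤ ((L : ℝ) ^ (-γ)) ^ j := pow_nonneg (Real.rpow_nonneg hL0.le _) _
    have hse : 0 ≤ ((L : ℝ) ^ j / (L : ℝ) ^ k) ^ (e - α) := Real.rpow_nonneg hs.le _
    have : K₁ * ((L : ℝ) ^ (-γ)) ^ j + K₂ * ((L : ℝ) ^ (-(α' - α))) ^ j ≤ (K₁ + K₂ + 1) * ((L : ℝ) ^ (-γ)) ^ j := by
      nlinarith [mul_le_mul_of_nonneg_left h2 hK₂]
    calc (K₁ * ((L : ℝ) ^ (-γ)) ^ j + K₂ * ((L : ℝ) ^ (-(α' - α))) ^ j) * ((L : ℝ) ^ j / (L : ℝ) ^ k) ^ (e - α) * W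
        ≤ ((K₁ + K₂ + 1) * ((L : ℝ) ^ (-γ)) ^ j) * ((L : ℝ) ^ j / (L : ℝ) ^ k) ^ (e - α) * W :=
          mul_le_mul_of_nonneg_right (mul_le_mul_of_nonneg_right this hse) hW
      _ = (K₁ + K₂ + 1) * (((L : ℝ) ^ j / (L : ℝ) ^ k) ^ (e - α) * ((L : ℝ) ^ (-γ)) ^ j) * W := by ring
  refine ⟨?_, fun μ => ?_⟩
  · -- line (3.75)₁: `F = G_(j)`, `e = 2 − D`, Hölder letters `Ha`
    have hR : ∀ u z : Tor (fine (L ^ (k + n)) M), |(kingSliceKernels L (k + n) eM M hM hk' a msq).G (j + n) u z - (kingSliceKernels L k eM M hM hk a msq).G j (kingSlicePt L k n M u) (kingSlicePt L k n M z)|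
        ≤ C₁ * ((L : ℝ) ^ (-(1 / 4 : ℝ))) ^ j * ((L : ℝ) ^ j / (L : ℝ) ^ k) ^ ((2 : ℝ) - (d + 1 : ℕ))
            * Real.exp (-(δ₁ * ((L : ℝ) ^ j / (L : ℝ) ^ k)⁻¹ * (kingSliceKernels L k eM M hM hk a msq).dist (kingSlicePt L k n M u) (kingSlicePt L k n M z))) := by
      intro u z
      have h := (H₁ k n eM hk hn M hM msq hmsq hcap j (by rw [kingSlicesTwoSpacing_lok]; omega) u z).1
      simp only [kingSlicesTwoSpacing_lo, kingSliceKernels_L, kingSliceKernels_k, kingSliceKernels_slice, kingSlicesTwoSpacing_pt,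
        kingSlicesTwoSpacing_hiG'] at h
      rw [mul_assoc C₁, hrate] at h
      calc _ ≤ _ := h
        _ = _ := by ring
    have hHhi : ∀ u v w : Tor (fine (L ^ (k + n)) M), 0 < (kingSliceKernels L (k + n) eM M hM hk' a msq).dist u v → |holderDeriv (kingSliceKernels L (k + n) eM M hM hk' a msq).dist α' ((kingSliceKernels L (k + n) eM M hM hk' a msq).G (j + n)) u v w|
        ≤ C₂ * ((L : ℝ) ^ j / (L : ℝ) ^ k) ^ ((2 : ℝ) - (d + 1 : ℕ) - α') * Real.exp (-(δ₂ * ((L : ℝ) ^ j / (L : ℝ) ^ k)⁻¹ * min ((kingSliceKernels L (k + n) eM M hM hk' a msq).dist u w) ((kingSliceKernels L (k + n) eM M hM hk' a msq).dist v w))) := by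
      intro u v w huv
      have h := Ha (k + n) eM hk' M hM msq hmsq hcap (j + n) (by omega) hα'0 hα'1 u v w huv
      rw [hslice_hi] at h
      exact h.trans (hmonoH _ _ (le_min (hdhi _ _) (hdhi _ _)) hca hda)
    have hHlo : ∀ u v w : Tor (fine (L ^ k) M), 0 < (kingSliceKernels L k eM M hM hk a msq).dist u v → |holderDeriv (kingSliceKernels L k eM M hM hk a msq).dist α' ((kingSliceKernels L k eM M hM hk a msq).G j) u v w|
        ≤ C₂ * ((L : ℝ) ^ j / (L : ℝ) ^ k) ^ ((2 : ℝ) - (d + 1 : ℕ) - α') * Real.exp (-(δ₂ * ((L : ℝ) ^ j / (L : ℝ) ^ k)⁻¹ * min ((kingSliceKernels L k eM M hM hk a msq).dist u w) ((kingSliceKernels L k eM M hM hk a msq).dist v w))) := by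
      intro u v w huv
      have h := Ha k eM hk M hM msq hmsq hcap j (by omega) hα'0 hα'1 u v w huv
      rw [hslice_lo] at h
      exact h.trans (hmonoH _ _ (le_min (hdlo _ _) (hdlo _ _)) hca hda)
    have key := twoSpacing_holderLine (kingSlicePt L k n M) (kingSliceKernels L (k + n) eM M hM hk' a msq).dist (kingSliceKernels L k eM M hM hk a msq).dist ((kingSliceKernels L (k + n) eM M hM hk' a msq).G (j + n)) ((kingSliceKernels L k eM M hM hk a msq).G j)
      (e := (2 : ℝ) - (d + 1 : ℕ)) hα0 hαα' hα'1.le hs hs1 hη hη1 hρ hC₁ hC₂ hδ₁ hδ₂ hdhi hdlo hgeo1 hgeo2 hgeo3 hR hHhi hHlo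
      x' y' z' hxy hxy'
    exact key.trans (hfinal _ _ (Real.exp_nonneg _))
  · -- line (3.75)₂: `F = ∂_μG_(j)`, `e = 1 − D`, Hölder letters `Hb`
    have hR : ∀ u z : Tor (fine (L ^ (k + n)) M), |(kingSliceKernels L (k + n) eM M hM hk' a msq).dG (j + n) μ u z - (kingSliceKernels L k eM M hM hk a msq).dG j μ (kingSlicePt L k n M u) (kingSlicePt L k n M z)|
        ≤ C₁ * ((L : ℝ) ^ (-(1 / 4 : ℝ))) ^ j * ((L : ℝ) ^ j / (L : ℝ) ^ k) ^ ((1 : ℝ) - (d + 1 : ℕ))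
            * Real.exp (-(δ₁ * ((L : ℝ) ^ j / (L : ℝ) ^ k)⁻¹ * (kingSliceKernels L k eM M hM hk a msq).dist (kingSlicePt L k n M u) (kingSlicePt L k n M z))) := by
      intro u z
      have h := (H₁ k n eM hk hn M hM msq hmsq hcap j (by rw [kingSlicesTwoSpacing_lok]; omega) u z).2 μ
      simp only [kingSlicesTwoSpacing_lo, kingSliceKernels_L, kingSliceKernels_k, kingSliceKernels_slice, kingSlicesTwoSpacing_pt,
        kingSlicesTwoSpacing_hidG'] at h
      rw [mul_assoc C₁, hrate] at h
      calc _ ≤ _ := h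
        _ = _ := by ring
    have hHhi : ∀ u v w : Tor (fine (L ^ (k + n)) M), 0 < (kingSliceKernels L (k + n) eM M hM hk' a msq).dist u v → |holderDeriv (kingSliceKernels L (k + n) eM M hM hk' a msq).dist α' ((kingSliceKernels L (k + n) eM M hM hk' a msq).dG (j + n) μ) u v w|
        ≤ C₂ * ((L : ℝ) ^ j / (L : ℝ) ^ k) ^ ((1 : ℝ) - (d + 1 : ℕ) - α') * Real.exp (-(δ₂ * ((L : ℝ) ^ j / (L : ℝ) ^ k)⁻¹ * min ((kingSliceKernels L (k + n) eM M hM hk' a msq).dist u w) ((kingSliceKernels L (k + n) eM M hM hk' a msq).dist v w))) := by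
      intro u v w huv
      have h := Hb (k + n) eM hk' M hM msq hmsq hcap (j + n) (by omega) μ u v w huv
      rw [hslice_hi] at h
      exact h.trans (hmonoH _ _ (le_min (hdhi _ _) (hdhi _ _)) hcb hdb)
    have hHlo : ∀ u v w : Tor (fine (L ^ k) M), 0 < (kingSliceKernels L k eM M hM hk a msq).dist u v → |holderDeriv (kingSliceKernels L k eM M hM hk a msq).dist α' ((kingSliceKernels L k eM M hM hk a msq).dG j μ) u v w|
        ≤ C₂ * ((L : ℝ) ^ j / (L : ℝ) ^ k) ^ ((1 : ℝ) - (d + 1 : ℕ) - α') * Real.exp (-(δ₂ * ((L : ℝ) ^ j / (L : ℝ) ^ k)⁻¹ * min ((kingSliceKernels L k eM M hM hk a msq).dist u w) ((kingSliceKernels L k eM M hM hk a msq).dist v w))) := by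
      intro u v w huv
      have h := Hb k eM hk M hM msq hmsq hcap j (by omega) μ u v w huv
      rw [hslice_lo] at h
      exact h.trans (hmonoH _ _ (le_min (hdlo _ _) (hdlo _ _)) hcb hdb)
    have key := twoSpacing_holderLine (kingSlicePt L k n M) (kingSliceKernels L (k + n) eM M hM hk' a msq).dist (kingSliceKernels L k eM M hM hk a msq).dist ((kingSliceKernels L (k + n) eM M hM hk' a msq).dG (j + n) μ) ((kingSliceKernels L k eM M hM hk a msq).dG j μ)
      (e := (1 : ℝ) - (d + 1 : ℕ)) hα0 hαα' hα'1.le hs hs1 hη hη1 hρ hC₁ hC₂ hδ₁ hδ₂ hdhi hdlo hgeo1 hgeo2 hgeo3 hR hHhi hHlo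
      x' y' z' hxy hxy'
    exact key.trans (hfinal _ _ (Real.exp_nonneg _))

end Holder

end Summit.QuantumFields.YangMills.BalabanUVNodes.N15KingModelRung.Curved

end
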